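import Summits.Ventures.CertifiedManyBodySolver.Rows.RectMarginalNodesGS
import HarnessLib

/-!
# SDA dual-certificate soundness edges: weak duality for the window-LTI nodes `LTIRectNode` / `LTIRectGSNode`

HONEST FRAMING: first certified bounds; not a superconductivity verdict; every number certified-of-record or labelled FLOAT.
This module proves SOUNDNESS (weak-duality) statements only; it certifies no new number.

Cell `hubbard-algo`, seat p3 (planner), TARGET.md §8 WANTED-7 (i)+(ii).  The seat's "SDA" certificates (symmetric dual
ansatz, SDA-RESULTS.md v1.2: classes TA ⊂ TU ⊂ Tn ⊂ T2 ⊂ T2+EOM on the open `3 × 3` window at `(t,U,n) = (1,8,7/8)`) are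
ROUNDED LAGRANGIAN DUAL POINTS of the tree's primal window nodes of `Rows/RectMarginalNodes*.lean`:

* a weighted cluster Hamiltonian `h(R; t,U,J,V,μ') ∈ 𝔄_R`, `R ⊆ W = [0,a) × [0,b)`, bond weights summing to `1` per
  direction, interaction weights summing to `1`, free site potentials `μ'` (classes TA/TU; the multipliers of the
  density row), embedded by isotony `Γ(R ↪ W)`;
* minus a DUAL ELEMENT `E ∈ 𝔄_W` of the node — an operator whose real expectation is `≥ 0` on every feasible point:
  LTI-null transfer combinations `Σ λ (Γ(S ↪ W)A − Γ(S → S+v ↪ W)A)` (classes Tn/T2: the multipliers of the LTI rows,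
  `IsLTINull`, any sign), PSD slack, density / `S^z` multipliers, and — for the ground-state-class node — nonnegative
  multiples of the stability rows `Γ(Ãᴴ[H_{Λ⁺},Ã])` and ARBITRARY complex multiples of the stationarity ("EOM")
  observables `Γ([H_{Λ⁺},Ã])` (class T2+EOM), whose vanishing on feasible points is DERIVED here from the stability rows
  by polarisation (`trace_commObs_eq_zero`: the rows for `A + c·1`, all `c ∈ ℂ`, force `Tr ρ Γ([H,Ã]) = 0`);
* minus a constant `c`, with the single numerical claim `Γ(h) − E − c·1 ⪰ 0` (one PSD claim node per certificate,
  checked sector-wise by the engine; the same epistemic status as the landed frozen family of `SdaClusterWitness.lean`).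

EDGES (weak duality, a few lines of trace algebra on top of the landed LTI dictionary `WindowLTI.wfun_clusterHamiltonian`):
`ltiRectNode_of_dualCert : … ⇒ LTIRectNode t U a b n (c − (Σμ')·n)` (every real `U`, every `n`; with
`LTIRectNode.tiStateNode` a bound for EVERY translation-invariant state of density `n`), and
`ltiRectGSNode_of_dualCert : … ⇒ LTIRectGSNode t U a b n (c − (Σμ')·n)` (with `LTIRectGSNode.le_energyDensity2D`:
`≤ e(t,U,n)` for `U ≥ 0`, `0 ≤ n < 2`, `a,b ≥ 2`; cells `M3EnergyLowerRow` / `M2EnergyLowerRow`).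
Consequently EVERY SDA class is kernel-sound modulo its PSD claim node, on ANY window, at ANY `(t,U,n)`; in particular the
SDA-T2+EOM row set is a SUBSET of the rows of `LTIRectGSNode 1 8 3 3 (7/8)` (answer to the cell's WANTED-6: a certified
SDA-T2+EOM value is `≤` the optimum of that node, which is `≤ CAP(3,3)`).

References: [cite: ValentiStolzeHirschfeld1991, §II] (TI / RDM lower bounds); [cite: Anderson1951, eq. (2)]; ground-state local stability as
landed (`IsTorusLimitOf.localStability`, used only through `LTIRectGSNode.le_energyDensity2D`).  No Literature fact minted; no instance / notation.
-/

noncomputable section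

open Matrix Complex Finset
open scoped ComplexOrder MatrixOrder BigOperators
open Literature.Probability.LatticeModels
open Literature.MathematicalPhysics.QuantumLattice
open Literature.MathematicalPhysics.QuantumLattice.AndersonCluster
open Literature.MathematicalPhysics.QuantumLattice.HubbardWave0
open Literature.MathematicalPhysics.QuantumLattice.ThermodynamicLimit
open Summit.Ventures.CertifiedManyBodySolver.Rows.RectMarginalNodes

namespace Summit.Ventures.CertifiedManyBodySolver.HubbardAlg.SdaDualEdge

/-! ## §1  LTI-null window operators (the span of the transfer / reweighting multipliers: classes Tn, T2) -/

section LTINull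

variable {W : Finset (Site 2)}

/-- `T ∈ 𝔄_W` is LTI-NULL: `Tr ρ T = 0` for every window-LTI matrix `ρ` (the annihilator of the LTI row space). -/
def IsLTINull (T : FermionOp W) : Prop :=
  ∀ ρ : FermionOp W, WindowLTI ρ → (ρ * T).trace = 0

/-- **The transfer generator**: `Γ(S ↪ W) A − Γ(S → S+v ↪ W) A` is LTI-null for every sub-region `S`, shift `v` with
`S, S+v ⊆ W` and every `A ∈ 𝔄_S` (definition of `WindowLTI`).  SDA classes Tn (`A = n_x`) and T2 (`A` up to two-body). -/
theorem isLTINull_transfer (S : Finset (Site 2)) (v : Site 2) (hS : S ⊆ W) (hSv : shiftSet v S ⊆ W) (A : FermionOp S) :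
    IsLTINull (fermionEmbed (PolySite.incl hS) A - fermionEmbed ((PolySite.shiftEmb v S).trans (PolySite.incl hSv)) A) :=
  fun ρ hρ => by rw [Matrix.mul_sub, Matrix.trace_sub, hρ S v hS hSv A, sub_self]

/-- `0` is LTI-null. -/
theorem IsLTINull.zero : IsLTINull (0 : FermionOp W) := fun ρ _ => by rw [Matrix.mul_zero, Matrix.trace_zero]

/-- LTI-null operators are closed under addition. -/
theorem IsLTINull.add {T T' : FermionOp W} (hT : IsLTINull T) (hT' : IsLTINull T') : IsLTINull (T + T') :=
  fun ρ hρ => by rw [Matrix.mul_add, Matrix.trace_add, hT ρ hρ, hT' ρ hρ, add_zero]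

/-- LTI-null operators are closed under subtraction. -/
theorem IsLTINull.sub {T T' : FermionOp W} (hT : IsLTINull T) (hT' : IsLTINull T') : IsLTINull (T - T') :=
  fun ρ hρ => by rw [Matrix.mul_sub, Matrix.trace_sub, hT ρ hρ, hT' ρ hρ, sub_zero]

/-- LTI-null operators are closed under negation. -/
theorem IsLTINull.neg {T : FermionOp W} (hT : IsLTINull T) : IsLTINull (-T) :=
  fun ρ hρ => by rw [Matrix.mul_neg, Matrix.trace_neg, hT ρ hρ, neg_zero]

/-- LTI-null operators are closed under complex scalars (multipliers of equality rows have free sign / phase). -/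
theorem IsLTINull.smul {T : FermionOp W} (hT : IsLTINull T) (c : ℂ) : IsLTINull (c • T) :=
  fun ρ hρ => by rw [Matrix.mul_smul, Matrix.trace_smul, hT ρ hρ, smul_zero]

/-- LTI-null operators are closed under finite sums. -/
theorem IsLTINull.sum {κ : Type*} (s : Finset κ) {T : κ → FermionOp W} (hT : ∀ k ∈ s, IsLTINull (T k)) :
    IsLTINull (∑ k ∈ s, T k) :=
  fun ρ hρ => by
    rw [Finset.mul_sum, Matrix.trace_sum]
    exact Finset.sum_eq_zero fun k hk => hT k hk ρ hρ

/-- A finite linear combination of transfer generators (the shape of an SDA Tn / T2 multiplier table) is LTI-null. -/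
theorem isLTINull_sum_smul_transfer {κ : Type*} (s : Finset κ) (S : κ → Finset (Site 2)) (v : κ → Site 2)
    (hS : ∀ k, S k ⊆ W) (hSv : ∀ k, shiftSet (v k) (S k) ⊆ W) (A : ∀ k, FermionOp (S k)) (lam : κ → ℂ) :
    IsLTINull (∑ k ∈ s, lam k • (fermionEmbed (PolySite.incl (hS k)) (A k) -
      fermionEmbed ((PolySite.shiftEmb (v k) (S k)).trans (PolySite.incl (hSv k))) (A k))) :=
  IsLTINull.sum s fun k _ => (isLTINull_transfer (S k) (v k) (hS k) (hSv k) (A k)).smul (lam k)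

end LTINull

/-! ## §2  The stationarity ("EOM") observables and their vanishing from the stability rows (polarisation) -/

section Stationarity

variable {W : Finset (Site 2)} (t U : ℝ)

/-- The local commutator `[H_{Λ⁺}, Ã] ∈ 𝔄_{Λ⁺}` (`Λ⁺ = thicken Λ 1`, `Ã = Γ(Λ ↪ Λ⁺) A`): the EOM / stationarity observable. -/
def commObs (Λ : Finset (Site 2)) (A : FermionOp Λ) : FermionOp (thicken Λ 1) :=
  (hubbardFermionInteraction 2 t U).localHamiltonian (thicken Λ 1) * fermionEmbed (PolySite.incl (subset_thicken Λ 1)) A -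
    fermionEmbed (PolySite.incl (subset_thicken Λ 1)) A * (hubbardFermionInteraction 2 t U).localHamiltonian (thicken Λ 1)

/-- `stabilityObs A = Ãᴴ · commObs A` (definitional). -/
theorem stabilityObs_eq (Λ : Finset (Site 2)) (A : FermionOp Λ) :
    stabilityObs t U Λ A = (fermionEmbed (PolySite.incl (subset_thicken Λ 1)) A)ᴴ * commObs t U Λ A := rfl

/-- **Polarisation identity**: `stabilityObs (A + c·1) = stabilityObs A + c̄ · commObs A`. -/
theorem stabilityObs_add_smul_one (Λ : Finset (Site 2)) (A : FermionOp Λ) (c : ℂ) :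
    stabilityObs t U Λ (A + c • 1) = stabilityObs t U Λ A + star c • commObs t U Λ A := by
  rw [stabilityObs_eq, stabilityObs_eq]
  set H := (hubbardFermionInteraction 2 t U).localHamiltonian (thicken Λ 1)
  set X := fermionEmbed (PolySite.incl (subset_thicken Λ 1)) A
  have hX : fermionEmbed (PolySite.incl (subset_thicken Λ 1)) (A + c • 1) = X + c • 1 := by
    rw [map_add, map_smul, map_one]
  have hc : commObs t U Λ (A + c • 1) = commObs t U Λ A := by
    unfold commObs
    rw [hX, Matrix.mul_add, Matrix.add_mul, Matrix.mul_smul, Matrix.smul_mul, Matrix.mul_one, Matrix.one_mul]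
    abel
  rw [hc, hX, Matrix.conjTranspose_add, Matrix.conjTranspose_smul, Matrix.conjTranspose_one, Matrix.add_mul,
    Matrix.smul_mul, Matrix.one_mul]

/-- **Stationarity from stability (polarisation)**: if the stability rows hold for `A + c·1` for every `c ∈ ℂ`, then the EOM
row `Tr ρ Γ([H_{Λ⁺}, Ã]) = 0` holds (`0 ≤ r + c̄ z` for all `c` forces `z = 0`). -/
theorem trace_commObs_eq_zero {ρ : FermionOp W} {Λ : Finset (Site 2)} (hΛ : thicken Λ 1 ⊆ W) (A : FermionOp Λ)
    (h : ∀ c : ℂ, 0 ≤ (ρ * fermionEmbed (PolySite.incl hΛ) (stabilityObs t U Λ (A + c • 1))).trace) :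
    (ρ * fermionEmbed (PolySite.incl hΛ) (commObs t U Λ A)).trace = 0 := by
  set r := (ρ * fermionEmbed (PolySite.incl hΛ) (stabilityObs t U Λ A)).trace with hr
  set z := (ρ * fermionEmbed (PolySite.incl hΛ) (commObs t U Λ A)).trace with hz
  have key : ∀ c : ℂ, 0 ≤ r + star c * z := fun c => by
    have h1 := h c
    rwa [stabilityObs_add_smul_one, map_add, map_smul, Matrix.mul_add, Matrix.mul_smul, Matrix.trace_add,
      Matrix.trace_smul, smul_eq_mul] at h1
  by_contra hne
  have hpos : 0 < Complex.normSq z := Complex.normSq_pos.2 hne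
  have h1 := key (-(((((r.re + 1) / Complex.normSq z : ℝ)) : ℂ) * z))
  have h2 : star (-(((((r.re + 1) / Complex.normSq z : ℝ)) : ℂ) * z)) * z =
      -((((r.re + 1) / Complex.normSq z * Complex.normSq z : ℝ)) : ℂ) := by
    rw [star_neg, star_mul', Complex.star_def, Complex.conj_ofReal, neg_mul, mul_assoc,
      ← Complex.normSq_eq_conj_mul_self, ← Complex.ofReal_mul]
  rw [h2, div_mul_cancel₀ _ hpos.ne'] at h1
  have h3 := (Complex.nonneg_iff.1 h1).1
  rw [Complex.add_re, Complex.neg_re, Complex.ofReal_re] at h3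
  linarith

end Stationarity

/-! ## §3  The dual cones of the two primal nodes and their generators -/

section Dual

variable (t U : ℝ) (a b : ℕ) (n : ℝ)

/-- **Dual cone of the LTI rectangle node**: `E ∈ 𝔄_W` with `Re Tr ρ E ≥ 0` on every feasible point of
`LTIRectNode t U a b n ·` (rows: PSD, trace one, window-LTI, density). -/
def LTIRectDual (E : FermionOp (rectWindow a b)) : Prop :=
  ∀ ρ : FermionOp (rectWindow a b), ρ.PosSemidef → ρ.trace = 1 → WindowLTI ρ →
    ((ρ * totalNumber).trace).re = ((a : ℝ) * b) * n → 0 ≤ ((ρ * E).trace).re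

/-- **Dual cone of the ground-state-class node**: `Re Tr ρ E ≥ 0` on every feasible point of `LTIRectGSNode t U a b n ·`
(rows: PSD, trace one, window-LTI, density, `S^z`, local stability). -/
def LTIRectGSDual (E : FermionOp (rectWindow a b)) : Prop :=
  ∀ ρ : FermionOp (rectWindow a b), ρ.PosSemidef → ρ.trace = 1 → WindowLTI ρ →
    ((ρ * totalNumber).trace).re = ((a : ℝ) * b) * n →
    (∀ σ : Fin 2, ((ρ * ∑ y : PolySite (rectWindow a b), numberOp y σ).trace).re = ((a : ℝ) * b) * (n / 2)) →
    (∀ (Λ : Finset (Site 2)) (hΛ : thicken Λ 1 ⊆ rectWindow a b) (A : FermionOp Λ),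
        Commute A totalNumber → Commute A HubbardWave0.spinZ →
        0 ≤ (ρ * fermionEmbed (PolySite.incl hΛ) (stabilityObs t U Λ A)).trace) →
    0 ≤ ((ρ * E).trace).re

variable {t U a b n}

/-- Every dual element of the LTI node is a dual element of the ground-state-class node (more rows, bigger cone). -/
theorem LTIRectDual.gsDual {E : FermionOp (rectWindow a b)} (hE : LTIRectDual a b n E) : LTIRectGSDual t U a b n E :=
  fun ρ h1 h2 h3 h4 _ _ => hE ρ h1 h2 h3 h4

/-- LTI-null operators (transfer multipliers, any sign / phase) are dual elements. -/
theorem LTIRectDual.of_isLTINull {T : FermionOp (rectWindow a b)} (hT : IsLTINull T) : LTIRectDual a b n T :=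
  fun ρ _ _ hlti _ => by rw [hT ρ hlti, Complex.zero_re]

/-- PSD operators (slack) are dual elements. -/
theorem LTIRectDual.of_posSemidef {P : FermionOp (rectWindow a b)} (hP : P.PosSemidef) : LTIRectDual a b n P :=
  fun _ hpsd _ _ _ => Literature.LinearAlgebra.Matrix.re_trace_mul_nonneg_of_posSemidef hpsd hP

/-- The density multiplier: `ν (N_W − a b n · 1)` is a dual element for every real `ν`. -/
theorem LTIRectDual.density (ν : ℝ) :
    LTIRectDual a b n ((ν : ℂ) • totalNumber - ((ν * ((a : ℝ) * b * n) : ℝ) : ℂ) • (1 : FermionOp (rectWindow a b))) := by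
  intro ρ _ htr _ hdens
  have h0 : ((ρ * ((ν : ℂ) • totalNumber - ((ν * ((a : ℝ) * b * n) : ℝ) : ℂ) • (1 : FermionOp (rectWindow a b)))).trace).re = 0 := by
    rw [Matrix.mul_sub, Matrix.trace_sub, Matrix.mul_smul, Matrix.trace_smul, Matrix.mul_smul, Matrix.trace_smul,
      Matrix.mul_one, htr, smul_eq_mul, smul_eq_mul, mul_one, Complex.sub_re, Complex.mul_re, Complex.ofReal_re,
      Complex.ofReal_im, zero_mul, sub_zero, hdens, Complex.ofReal_re]
    ring
  rw [h0]

/-- Dual elements are closed under addition. -/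
theorem LTIRectDual.add {E E' : FermionOp (rectWindow a b)} (hE : LTIRectDual a b n E) (hE' : LTIRectDual a b n E') :
    LTIRectDual a b n (E + E') := fun ρ h1 h2 h3 h4 => by
  rw [Matrix.mul_add, Matrix.trace_add, Complex.add_re]
  exact add_nonneg (hE ρ h1 h2 h3 h4) (hE' ρ h1 h2 h3 h4)

/-- Dual elements are closed under nonnegative real scalars. -/
theorem LTIRectDual.smul_nonneg {E : FermionOp (rectWindow a b)} (hE : LTIRectDual a b n E) {γ : ℝ} (hγ : 0 ≤ γ) :
    LTIRectDual a b n ((γ : ℂ) • E) := fun ρ h1 h2 h3 h4 => by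
  rw [Matrix.mul_smul, Matrix.trace_smul, smul_eq_mul, Complex.mul_re, Complex.ofReal_re, Complex.ofReal_im, zero_mul,
    sub_zero]
  exact mul_nonneg hγ (hE ρ h1 h2 h3 h4)

/-- Dual elements are closed under finite sums. -/
theorem LTIRectDual.sum {κ : Type*} (s : Finset κ) {E : κ → FermionOp (rectWindow a b)}
    (hE : ∀ k ∈ s, LTIRectDual a b n (E k)) : LTIRectDual a b n (∑ k ∈ s, E k) := fun ρ h1 h2 h3 h4 => by
  rw [Finset.mul_sum, Matrix.trace_sum, Complex.re_sum]
  exact Finset.sum_nonneg fun k hk => hE k hk ρ h1 h2 h3 h4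

/-- LTI-null operators are dual elements of the ground-state-class node. -/
theorem LTIRectGSDual.of_isLTINull {T : FermionOp (rectWindow a b)} (hT : IsLTINull T) : LTIRectGSDual t U a b n T :=
  (LTIRectDual.of_isLTINull hT).gsDual

/-- PSD operators are dual elements of the ground-state-class node. -/
theorem LTIRectGSDual.of_posSemidef {P : FermionOp (rectWindow a b)} (hP : P.PosSemidef) : LTIRectGSDual t U a b n P :=
  (LTIRectDual.of_posSemidef hP).gsDual

/-- **The stability multiplier**: `γ · Γ(Λ⁺ ↪ W)(Ãᴴ[H_{Λ⁺},Ã])`, `γ ≥ 0`, for gauge-invariant local `A`, is a dual element. -/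
theorem LTIRectGSDual.stability {Λ : Finset (Site 2)} (hΛ : thicken Λ 1 ⊆ rectWindow a b) (A : FermionOp Λ)
    (hN : Commute A totalNumber) (hS : Commute A HubbardWave0.spinZ) {γ : ℝ} (hγ : 0 ≤ γ) :
    LTIRectGSDual t U a b n ((γ : ℂ) • fermionEmbed (PolySite.incl hΛ) (stabilityObs t U Λ A)) := by
  intro ρ _ _ _ _ _ hstab
  rw [Matrix.mul_smul, Matrix.trace_smul, smul_eq_mul, Complex.mul_re, Complex.ofReal_re, Complex.ofReal_im, zero_mul,
    sub_zero]
  exact mul_nonneg hγ (Complex.nonneg_iff.1 (hstab Λ hΛ A hN hS)).1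

/-- **The EOM / stationarity multiplier**: `δ · Γ(Λ⁺ ↪ W)([H_{Λ⁺},Ã])` is a dual element for EVERY `δ ∈ ℂ` and every
gauge-invariant local `A` (its expectation vanishes on feasible points, `trace_commObs_eq_zero`). -/
theorem LTIRectGSDual.commutator {Λ : Finset (Site 2)} (hΛ : thicken Λ 1 ⊆ rectWindow a b) (A : FermionOp Λ)
    (hN : Commute A totalNumber) (hS : Commute A HubbardWave0.spinZ) (δ : ℂ) :
    LTIRectGSDual t U a b n (δ • fermionEmbed (PolySite.incl hΛ) (commObs t U Λ A)) := by
  intro ρ _ _ _ _ _ hstab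
  have h0 := trace_commObs_eq_zero t U hΛ A fun c =>
    hstab Λ hΛ (A + c • 1) (hN.add_left ((Commute.one_left _).smul_left c)) (hS.add_left ((Commute.one_left _).smul_left c))
  rw [Matrix.mul_smul, Matrix.trace_smul, h0, smul_zero, Complex.zero_re]

/-- **The `S^z` multiplier**: `ν (N_{W,σ} − a b n/2 · 1)` is a dual element for every real `ν` and each spin `σ`. -/
theorem LTIRectGSDual.spin (ν : ℝ) (σ : Fin 2) :
    LTIRectGSDual t U a b n ((ν : ℂ) • ∑ y : PolySite (rectWindow a b), numberOp y σ -
      ((ν * ((a : ℝ) * b * (n / 2)) : ℝ) : ℂ) • (1 : FermionOp (rectWindow a b))) := by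
  intro ρ _ htr _ _ hspin _
  have h0 : ((ρ * ((ν : ℂ) • ∑ y : PolySite (rectWindow a b), numberOp y σ -
      ((ν * ((a : ℝ) * b * (n / 2)) : ℝ) : ℂ) • (1 : FermionOp (rectWindow a b)))).trace).re = 0 := by
    rw [Matrix.mul_sub, Matrix.trace_sub, Matrix.mul_smul, Matrix.trace_smul, Matrix.mul_smul, Matrix.trace_smul,
      Matrix.mul_one, htr, smul_eq_mul, smul_eq_mul, mul_one, Complex.sub_re, Complex.mul_re, Complex.ofReal_re,
      Complex.ofReal_im, zero_mul, sub_zero, hspin σ, Complex.ofReal_re]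
    ring
  rw [h0]

/-- Closure under addition. -/
theorem LTIRectGSDual.add {E E' : FermionOp (rectWindow a b)} (hE : LTIRectGSDual t U a b n E)
    (hE' : LTIRectGSDual t U a b n E') : LTIRectGSDual t U a b n (E + E') := fun ρ h1 h2 h3 h4 h5 h6 => by
  rw [Matrix.mul_add, Matrix.trace_add, Complex.add_re]
  exact add_nonneg (hE ρ h1 h2 h3 h4 h5 h6) (hE' ρ h1 h2 h3 h4 h5 h6)

/-- Closure under nonnegative real scalars. -/
theorem LTIRectGSDual.smul_nonneg {E : FermionOp (rectWindow a b)} (hE : LTIRectGSDual t U a b n E) {γ : ℝ}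
    (hγ : 0 ≤ γ) : LTIRectGSDual t U a b n ((γ : ℂ) • E) := fun ρ h1 h2 h3 h4 h5 h6 => by
  rw [Matrix.mul_smul, Matrix.trace_smul, smul_eq_mul, Complex.mul_re, Complex.ofReal_re, Complex.ofReal_im, zero_mul,
    sub_zero]
  exact mul_nonneg hγ (hE ρ h1 h2 h3 h4 h5 h6)

/-- Closure under finite sums. -/
theorem LTIRectGSDual.sum {κ : Type*} (s : Finset κ) {E : κ → FermionOp (rectWindow a b)}
    (hE : ∀ k ∈ s, LTIRectGSDual t U a b n (E k)) : LTIRectGSDual t U a b n (∑ k ∈ s, E k) :=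
  fun ρ h1 h2 h3 h4 h5 h6 => by
    rw [Finset.mul_sum, Matrix.trace_sum, Complex.re_sum]
    exact Finset.sum_nonneg fun k hk => hE k hk ρ h1 h2 h3 h4 h5 h6

end Dual

/-! ## §4  The EDGES (weak duality): a PSD dual certificate is a valid floor of the primal node -/

section Edges

/-- **EDGE E1 (SDA classes TA/TU/Tn/T2 ⇒ `LTIRectNode`)**: `R ⊆ [0,a) × [0,b)` (`a,b ≥ 2`), bond weights `Σ_{∥e_0} J =
Σ_{∥e_1} J = 1`, interaction weights `Σ V = 1`, free potentials `μ'`, a dual element `E` (e.g. an LTI-null transfer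
combination) and `Γ(R ↪ W) h(R;J,V,μ') − E − c·1 ⪰ 0` give `LTIRectNode t U a b n (c − (Σμ')·n)` — every real `U`, every `n`.
Proof: `0 ≤ Re Tr ρ(Γh − E − c) = h̄b_0 + h̄b_1 + ū + (Σμ') n − Re Tr ρE − c` by the LTI dictionary and the density row,
`Re Tr ρE ≥ 0`, and `Re Tr ρ h_avg = h̄b_0 + h̄b_1 + ū`. -/
theorem ltiRectNode_of_dualCert (t U n : ℝ) {a b : ℕ} (ha : 2 ≤ a) (hb : 2 ≤ b) (R : Finset (Site 2))
    (hR : R ⊆ rectWindow a b) (J : Site 2 → Fin 2 → ℝ) (V μ : Site 2 → ℝ) (hJ0 : bondWeightSum R J 0 = 1)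
    (hJ1 : bondWeightSum R J 1 = 1) (hV : siteWeightSum R V = 1) {E : FermionOp (rectWindow a b)}
    (hE : LTIRectDual a b n E) {c : ℝ}
    (hK : (fermionEmbed (PolySite.incl hR) (clusterHamiltonian R t U J V μ) - E -
      (c : ℂ) • (1 : FermionOp (rectWindow a b))).PosSemidef) :
    LTIRectNode t U a b n (c - siteWeightSum R μ * n) := by
  intro ρ hpsd htr hlti hdens
  have hW := pair_subset_rectWindow ha hb
  have hpos := Literature.LinearAlgebra.Matrix.re_trace_mul_nonneg_of_posSemidef hpsd hK
  have hEv := hE ρ hpsd htr hlti hdens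
  have hval : (ρ * (fermionEmbed (PolySite.incl hR) (clusterHamiltonian R t U J V μ) - E -
      (c : ℂ) • (1 : FermionOp (rectWindow a b)))).trace =
      wfun ρ hR (clusterHamiltonian R t U J V μ) - (ρ * E).trace - c := by
    rw [Matrix.mul_sub, Matrix.mul_sub, Matrix.trace_sub, Matrix.trace_sub, Matrix.mul_smul, Matrix.trace_smul,
      Matrix.mul_one, htr, smul_eq_mul, mul_one, wfun_apply]
  rw [hval, hlti.wfun_clusterHamiltonian t U hW hR, hV, Fin.sum_univ_two, hJ0, hJ1] at hpos
  rw [trace_mul_eq_wfun, hAvg, hlti.wfun_clusterHamiltonian t U hW (subset_refl _), Fin.sum_univ_two,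
    bondWeightSum_avgBond_zero ha (by omega), bondWeightSum_avgBond_one (by omega) hb,
    siteWeightSum_avgSite (by omega) (by omega), siteWeightSum_zero]
  rw [hlti.trace_mul_totalNumber hW] at hdens
  have hcard := card_rectWindow' a b
  have hab : (0 : ℝ) < (a : ℝ) * b := by positivity
  have hd : (wDens ρ hW).re = n := by
    simp only [Complex.mul_re, Complex.natCast_re, Complex.natCast_im, zero_mul, sub_zero, hcard] at hdens
    exact mul_left_cancel₀ hab.ne' hdens
  simp only [Complex.add_re, Complex.sub_re, Complex.mul_re, Complex.ofReal_re, Complex.ofReal_im, zero_mul,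
    sub_zero, one_mul, hd] at hpos ⊢
  linarith

/-- **EDGE E2 (SDA class T2+EOM ⇒ `LTIRectGSNode`)**: as E1 with a dual element `E` of the ground-state-class node
(LTI-null transfers, `S^z` / density multipliers, stability multipliers `γ ≥ 0`, EOM multipliers `δ ∈ ℂ`, PSD slack). -/
theorem ltiRectGSNode_of_dualCert (t U n : ℝ) {a b : ℕ} (ha : 2 ≤ a) (hb : 2 ≤ b) (R : Finset (Site 2))
    (hR : R ⊆ rectWindow a b) (J : Site 2 → Fin 2 → ℝ) (V μ : Site 2 → ℝ) (hJ0 : bondWeightSum R J 0 = 1)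
    (hJ1 : bondWeightSum R J 1 = 1) (hV : siteWeightSum R V = 1) {E : FermionOp (rectWindow a b)}
    (hE : LTIRectGSDual t U a b n E) {c : ℝ}
    (hK : (fermionEmbed (PolySite.incl hR) (clusterHamiltonian R t U J V μ) - E -
      (c : ℂ) • (1 : FermionOp (rectWindow a b))).PosSemidef) :
    LTIRectGSNode t U a b n (c - siteWeightSum R μ * n) := by
  intro ρ hpsd htr hlti hdens hspin hstab
  have hW := pair_subset_rectWindow ha hb
  have hpos := Literature.LinearAlgebra.Matrix.re_trace_mul_nonneg_of_posSemidef hpsd hK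
  have hEv := hE ρ hpsd htr hlti hdens hspin hstab
  have hval : (ρ * (fermionEmbed (PolySite.incl hR) (clusterHamiltonian R t U J V μ) - E -
      (c : ℂ) • (1 : FermionOp (rectWindow a b)))).trace =
      wfun ρ hR (clusterHamiltonian R t U J V μ) - (ρ * E).trace - c := by
    rw [Matrix.mul_sub, Matrix.mul_sub, Matrix.trace_sub, Matrix.trace_sub, Matrix.mul_smul, Matrix.trace_smul,
      Matrix.mul_one, htr, smul_eq_mul, mul_one, wfun_apply]
  rw [hval, hlti.wfun_clusterHamiltonian t U hW hR, hV, Fin.sum_univ_two, hJ0, hJ1] at hpos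
  rw [trace_mul_eq_wfun, hAvg, hlti.wfun_clusterHamiltonian t U hW (subset_refl _), Fin.sum_univ_two,
    bondWeightSum_avgBond_zero ha (by omega), bondWeightSum_avgBond_one (by omega) hb,
    siteWeightSum_avgSite (by omega) (by omega), siteWeightSum_zero]
  rw [hlti.trace_mul_totalNumber hW] at hdens
  have hcard := card_rectWindow' a b
  have hab : (0 : ℝ) < (a : ℝ) * b := by positivity
  have hd : (wDens ρ hW).re = n := by
    simp only [Complex.mul_re, Complex.natCast_re, Complex.natCast_im, zero_mul, sub_zero, hcard] at hdens
    exact mul_left_cancel₀ hab.ne' hdens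
  simp only [Complex.add_re, Complex.sub_re, Complex.mul_re, Complex.ofReal_re, Complex.ofReal_im, zero_mul,
    sub_zero, one_mul, hd] at hpos ⊢
  linarith

/-! ## §5  Transport to the target quantities (by the landed soundness theorems of the primal nodes) -/

/-- E1 transported: a dual certificate of the LTI node bounds the energy density of EVERY translation-invariant state of
density `n` (every real `U`). -/
theorem tiStateNode_of_dualCert (t U n : ℝ) {a b : ℕ} (ha : 2 ≤ a) (hb : 2 ≤ b) (R : Finset (Site 2))
    (hR : R ⊆ rectWindow a b) (J : Site 2 → Fin 2 → ℝ) (V μ : Site 2 → ℝ) (hJ0 : bondWeightSum R J 0 = 1)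
    (hJ1 : bondWeightSum R J 1 = 1) (hV : siteWeightSum R V = 1) {E : FermionOp (rectWindow a b)}
    (hE : LTIRectDual a b n E) {c : ℝ}
    (hK : (fermionEmbed (PolySite.incl hR) (clusterHamiltonian R t U J V μ) - E -
      (c : ℂ) • (1 : FermionOp (rectWindow a b))).PosSemidef) :
    TIStateNode t U n (c - siteWeightSum R μ * n) :=
  (ltiRectNode_of_dualCert t U n ha hb R hR J V μ hJ0 hJ1 hV hE hK).tiStateNode ha hb

/-- E2 transported: a dual certificate of the ground-state-class node is a lower bound on `e(t,U,n)`
(`U ≥ 0`, `0 ≤ n < 2`). -/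
theorem energyDensity2D_ge_of_dualCert (t : ℝ) {U : ℝ} (hU : 0 ≤ U) {n : ℝ} (hn0 : 0 ≤ n) (hn2 : n < 2) {a b : ℕ}
    (ha : 2 ≤ a) (hb : 2 ≤ b) (R : Finset (Site 2)) (hR : R ⊆ rectWindow a b) (J : Site 2 → Fin 2 → ℝ)
    (V μ : Site 2 → ℝ) (hJ0 : bondWeightSum R J 0 = 1) (hJ1 : bondWeightSum R J 1 = 1) (hV : siteWeightSum R V = 1)
    {E : FermionOp (rectWindow a b)} (hE : LTIRectGSDual t U a b n E) {c : ℝ}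
    (hK : (fermionEmbed (PolySite.incl hR) (clusterHamiltonian R t U J V μ) - E -
      (c : ℂ) • (1 : FermionOp (rectWindow a b))).PosSemidef) :
    c - siteWeightSum R μ * n ≤ energyDensity2D t U n :=
  (ltiRectGSNode_of_dualCert t U n ha hb R hR J V μ hJ0 hJ1 hV hE hK).le_energyDensity2D hU ha hb hn0 hn2

/-- **Cell M3 at `t' = 0`**: a dual certificate of the ground-state-class node at `(t,U,n) = (1,8,7/8)` whose value
`c − (Σμ')·7/8` dominates the rational slot `lo` is an `M3EnergyLowerRow 0 lo`. -/
theorem m3EnergyLowerRow_of_dualCert {a b : ℕ} (ha : 2 ≤ a) (hb : 2 ≤ b) (R : Finset (Site 2))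
    (hR : R ⊆ rectWindow a b) (J : Site 2 → Fin 2 → ℝ) (V μ : Site 2 → ℝ) (hJ0 : bondWeightSum R J 0 = 1)
    (hJ1 : bondWeightSum R J 1 = 1) (hV : siteWeightSum R V = 1) {E : FermionOp (rectWindow a b)}
    (hE : LTIRectGSDual 1 8 a b (7 / 8) E) {c : ℝ}
    (hK : (fermionEmbed (PolySite.incl hR) (clusterHamiltonian R 1 8 J V μ) - E -
      (c : ℂ) • (1 : FermionOp (rectWindow a b))).PosSemidef) {lo : ℚ}
    (hlo : (lo : ℝ) ≤ c - siteWeightSum R μ * (7 / 8)) : M3EnergyLowerRow 0 lo :=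
  ((ltiRectGSNode_of_dualCert 1 8 (7 / 8) ha hb R hR J V μ hJ0 hJ1 hV hE hK).mono hlo).m3EnergyLowerRow ha hb

end Edges

end Summit.Ventures.CertifiedManyBodySolver.HubbardAlg.SdaDualEdge

end
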